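/- Copyright: the b2b-balaban cell (near-miss cell 7), T⁴-continuum fan-out, ROUND-2 swarm `t4-ne7b-formalise-*`
(leaf 09, gen 4), row NE7b (node U5c COUNT member).  Released under the licence of the surrounding project. -/
import Summits.QuantumFields.BalabanUV.T4Continuum.Support.HistoryRealiseCellsRunApexWitness
import Literature.MathematicalPhysics.QuantumFieldTheory.Balaban1983to89.T4ContinuumYM4Torus

/-!
# Realised histories: THE HEADLINE'S DISPLAYED ANTECEDENT `hData` IS INHABITED on one datum (row S12h, sibling of the toy witness)

Summits-side support leaf of the T⁴-continuum cell (rung (B)+1 on a FINITE torus only; NOT infinite volume, NOT the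
mass gap, NOT the Clay statement; NOT a proof of the spine estimate NE7b).  Sibling of
`Support/HistoryRealiseCellsRunApexWitness.lean` (p220350: ONE string — the empty one — at ONE tuned run `g₀ ≡ 1`).
Here the node test (t5, referee C-t4r2-347) is run on the EXACT per-datum binder of the headline
`HistoryRealiseCellsRunHeadline.continuumYM4Torus_of_countRoad_fsc` (p219850):
`hData : T4ContinuumYM4Torus.ForSmallCouplings D (fun g₀ => ∀ os, ∃ ι α π …, Nonempty (CountRoadWitness D C O rr d n g₀ os ι α π))`
— EVERY loop string and EVERY tuned run — on the toy datum `toyData F G` of the sibling, for a SUBSINGLETON regular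
gauge group `G`, instantiated at `SU(1) = Matrix.specialUnitaryGroup (Fin 1) ℂ`.

WHAT IS BUILT [decided toy; nothing of Bałaban's is modelled].
* §1 On a subsingleton gauge group every holonomy is `1`, so every loop variable is `reTr 1 = 1` (`loopAt_eq_one`) and
  the product observable of EVERY string is `1` (`prodObs_eq_one`); `SU(1)` is a subsingleton (`subsingleton_SU1`,
  from `Matrix.det_fin_one`).
* §2 The dressed integrals `ZtoyOf g₀ os K t` of the toy datum for a general run `g₀` and string `os`: positive
  (`ZtoyOf_pos`), and — whenever the string's product observable is identically `1` — source-factorised,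
  `ZtoyOf g₀ os K t = e^t · ZtoyOf g₀ os K 0` (`ZtoyOf_eq_exp_mul`), so the two-run log-ratio `nuToyOf` is source-free
  and the NE7 sandwich is an identity (`exp_nuToyOf_mul`).
* §3 The (2.5) size function at a general coupling `g`: `Rsz F rr g = L^{s⋆}` with `s⋆` the LEAST exponent such that
  `(log g⁻²)^rr ≤ L^{s⋆}` (`Nat.find`; exists by `1 < L` = `F.hL.2`), `isRj_Rsz : B14.IsRj F.L rr g (Rsz F rr g)`, `one_le_Rsz`.
* §4 **`toyWitnessOf`**: the sibling's 70-field term rebuilt for an arbitrary run `g₀` that is CONSTANT (`∀ K, g₀ K = g`)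
  and an arbitrary string whose product observable is `1` on the toy's lattices: `A K t () := ZtoyOf g₀ os K t`, no live
  component (all H3 fields vacuous, sibling's `not_mem_badTerms_toy` ∕ `not_mem_badClasses_toy`), zero shells ∕ dead
  weights ∕ envelopes, `floor` by `smallFieldMass_toy = 1`, `sites` by `numSites = 0`, `isRj` by §3 at `g`, the NE7
  budget met exactly with `Cc := nuToyOf`, rates `0`.
* §5 **`forSmallCouplings_countRoadWitness_toy`**: for a subsingleton `G`, the headline's `hData` holds on `toyData F G`
  (thresholds `γ₀ = g₁ = 1`; a tuned run of the constant-flow toy IS the constant sequence `g₀ ≡ g`, `tuned_const_iff`);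
  **`forSmallCouplings_countRoadWitness_toySU1`**: the instance at `SU(1)`, on every family `F`, for every `C O rr d n`.
  The sibling's `not_endStatementBPrinted_toy` records that (B) FAILS there — so the headline stays vacuous AT this datum
  and no contradiction is produced: the test certifies that `hData` is a satisfiable SHAPE, nothing else.

HONEST.  For a NON-trivial group and a non-empty string the budget's source-uniformity (`uv_const`∕`recent_deviation`
with summable rates) is NE7's two-run comparison itself and is available on no toy; the subsingleton group is exactly
what makes every string's observable constant.  Discharges NOTHING of the nine; NE7b NOT proved; spine 0∕9.  HONEST
DEPENDENCY (cell): continuum YM on T⁴ ⇐ BetaPertH ∧ nine spine estimates (0/9 proved); BetaPertH ⇐ (D1) ∧ (D4) ∧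
CAP+tail; G-an2-4 gates asym, D1 and NE2/3/4.  [folklore] decided toy on OUR carriers; no `[cite:]`; no
`def … : Prop`; nothing printed is asserted. -/

open Finset MeasureTheory
open Literature.MathematicalPhysics.QuantumFieldTheory.Balaban1983to89
open Literature.MathematicalPhysics.QuantumFieldTheory.Balaban1983to89.B13ScaleTransfer
open Literature.MathematicalPhysics.QuantumFieldTheory.Balaban1983to89.T4FiniteEpsInhabited
open Missing AveragingRT T4Continuum T4StabilitySocket T4MatchingClosure T4IndicatorShell T4LiveClassFibration
open T4RenewalChains T4PersistenceDictionary T4BranchingRecordsGas T4ContinuumYM4Torus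
open Summit.QuantumFields.BalabanUV.T4Continuum.HistoryConstants
open Summit.QuantumFields.BalabanUV.T4Continuum.HistoryGen
open Summit.QuantumFields.BalabanUV.T4Continuum.HistoryAssemblyTerms
open Summit.QuantumFields.BalabanUV.T4Continuum.HistoryAssemblyPedigree
open Summit.QuantumFields.BalabanUV.T4Continuum.HistorySocketTH
open Summit.QuantumFields.BalabanUV.T4Continuum.HistoryAssemblyRealiseRun
open Summit.QuantumFields.BalabanUV.T4Continuum.HistoryRealiseCellsRun
open Summit.QuantumFields.BalabanUV.T4Continuum.HistoryRealiseCellsRunApex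
open Summit.QuantumFields.BalabanUV.T4Continuum.HistoryRealiseCellsRunApexWitness

namespace Summit.QuantumFields.BalabanUV.T4Continuum.HistoryRealiseCellsRunApexWitnessData

noncomputable section

/-! ## §1 Loop variables on a subsingleton gauge group -/

section Subsingleton

variable (G : Type*) [GaugeGroup G] [Subsingleton G]

/-- on a subsingleton gauge group every holonomy is `1`, so every loop variable is `reTr 1 = 1` [folklore] -/
theorem loopAt_eq_one {P : Params} {j : ℕ} (U : GaugeField P j G) (γ : List (LStep P j)) : loopAt U γ = 1 := by
  rw [loopAt, Subsingleton.elim (holAt U γ) 1]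
  exact GaugeGroup.reTr_one

variable {G}
variable {F : T4Family} {G : Type*} [GaugeGroup G] [MeasurableSpace G] [HaarData G] [Subsingleton G]

/-- … hence the product observable of EVERY loop string is `1` on such a group [folklore] -/
theorem prodObs_eq_one (D : FiniteEpsData F G) (g₀ : ℕ → ℝ) (K : ℕ) (os : List (ULoop F))
    (U : GaugeField (F.P K) 0 G) : T4GenFunBounds.prodObs (D.scheme g₀) K os U = 1 := by
  have h : ∀ o : ULoop F, (D.scheme g₀).obs K o U = 1 := fun o => loopAt_eq_one G _ _
  unfold T4GenFunBounds.prodObs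
  exact List.prod_eq_one fun x hx => by
    obtain ⟨o, -, rfl⟩ := List.mem_map.1 hx
    exact h o

end Subsingleton

/-- `SU(1)` is a subsingleton: a unitary `1 × 1` matrix of determinant `1` is `1`. [folklore] -/
theorem subsingleton_SU1 : Subsingleton (Matrix.specialUnitaryGroup (Fin 1) ℂ) := by
  refine ⟨fun A B => Subtype.ext ?_⟩
  have hA := (Matrix.mem_specialUnitaryGroup_iff.1 A.2).2
  have hB := (Matrix.mem_specialUnitaryGroup_iff.1 B.2).2
  rw [Matrix.det_fin_one] at hA hB
  ext i j
  rw [Fin.fin_one_eq_zero i, Fin.fin_one_eq_zero j, hA, hB]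

/-! ## §2 The toy's dressed integrals for a general run and string -/

section Dressed

variable (F : T4Family) (G : Type) [GaugeGroup G] [MeasurableSpace G] [HaarData G] [RegularGaugeGroup G]

/-- the toy datum's dressed integral of run `K` at source `t`, run `g₀`, string `os` [decided toy] -/
def ZtoyOf (g₀ : ℕ → ℝ) (os : List (ULoop F)) (K : ℕ) (t : ℝ) : ℝ :=
  ∫ U, Real.exp (t * T4GenFunBounds.prodObs ((toyData F G).scheme g₀) K os U) *
    (toyData F G).dens K (g₀ K) 0 U ∂fieldMeasure (F.P K) 0 G

/-- positivity (`exists_const_dressedZ` + `dressedZ_pos`; the product observable is measurable and bounded by `1`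
because the toy's averagings are measurable) [decided toy] -/
theorem ZtoyOf_pos (g₀ : ℕ → ℝ) (os : List (ULoop F)) (K : ℕ) (t : ℝ) : 0 < ZtoyOf F G g₀ os K t := by
  obtain ⟨c, hc, -, h⟩ := exists_const_dressedZ (toyData F G) K (g₀ K)
  unfold ZtoyOf
  rw [h]
  have hm : ∀ K o, Measurable (((toyData F G).scheme g₀).obs K o) := fun K o =>
    (toyData F G).measurable_avgObs (measurable_toyAv F G) K o
  exact mul_pos hc (T4GenFunBounds.dressedZ_pos (F.P K) (sq_nonneg _)
    (T4GenFunBounds.measurable_prodObs ((toyData F G).scheme g₀) hm K os)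
    (fun U => T4GenFunBounds.abs_prodObs_le_one ((toyData F G).scheme g₀)
      (fun K o U => (toyData F G).abs_avgObs_le_one K o U) K os U) t)

/-- source factorisation WHEN the string's product observable is identically `1` [decided toy] -/
theorem ZtoyOf_eq_exp_mul {g₀ : ℕ → ℝ} {os : List (ULoop F)}
    (hobs : ∀ (K : ℕ) (U : GaugeField (F.P K) 0 G), T4GenFunBounds.prodObs ((toyData F G).scheme g₀) K os U = 1)
    (K : ℕ) (t : ℝ) : ZtoyOf F G g₀ os K t = Real.exp t * ZtoyOf F G g₀ os K 0 := by
  simp only [ZtoyOf, hobs, mul_one, Real.exp_zero, one_mul]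
  exact integral_const_mul _ _

/-- the two-run log-ratio of the toy for run `g₀` and string `os` [decided toy] -/
def nuToyOf (g₀ : ℕ → ℝ) (os : List (ULoop F)) (K : ℕ) : ℝ :=
  Real.log (ZtoyOf F G g₀ os (K + 1) 0 / ZtoyOf F G g₀ os K 0)

/-- the NE7 sandwich is an identity: `e^{nuToyOf K} · ZtoyOf K t = ZtoyOf (K+1) t` [decided toy] -/
theorem exp_nuToyOf_mul {g₀ : ℕ → ℝ} {os : List (ULoop F)}
    (hobs : ∀ (K : ℕ) (U : GaugeField (F.P K) 0 G), T4GenFunBounds.prodObs ((toyData F G).scheme g₀) K os U = 1)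
    (K : ℕ) (t : ℝ) : Real.exp (nuToyOf F G g₀ os K) * ZtoyOf F G g₀ os K t = ZtoyOf F G g₀ os (K + 1) t := by
  have h0 := ZtoyOf_pos F G g₀ os K 0
  have h1 := ZtoyOf_pos F G g₀ os (K + 1) 0
  rw [nuToyOf, Real.exp_log (div_pos h1 h0), ZtoyOf_eq_exp_mul F G hobs K t, ZtoyOf_eq_exp_mul F G hobs (K + 1) t]
  field_simp

end Dressed

/-! ## §3 The (2.5) size function at a general coupling -/

section Size

variable (F : T4Family) (rr : ℕ) (g : ℝ)

/-- some power of `L` dominates `(log g⁻²)^rr` (`1 < L`) [folklore] -/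
theorem exists_pow_ge : ∃ s : ℕ, (Real.log (g ^ 2)⁻¹) ^ rr ≤ ((F.L ^ s : ℕ) : ℝ) := by
  obtain ⟨s, hs⟩ := pow_unbounded_of_one_lt ((Real.log (g ^ 2)⁻¹) ^ rr) (by exact_mod_cast F.hL.2 : (1 : ℝ) < F.L)
  exact ⟨s, by rw [Nat.cast_pow]; exact hs.le⟩

open Classical in
/-- **THE SIZE `R_j` AT COUPLING `g`**: `L^{s⋆}` with `s⋆` the least admissible exponent [decided toy] -/
def Rsz : ℕ := F.L ^ Nat.find (exists_pow_ge F rr g)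

open Classical in
/-- `Rsz` satisfies (2.5) [decided toy] -/
theorem isRj_Rsz : B14.IsRj F.L rr g (Rsz F rr g) :=
  ⟨Nat.find (exists_pow_ge F rr g), rfl, Nat.find_spec (exists_pow_ge F rr g),
    fun _ hs' => Nat.find_min' (exists_pow_ge F rr g) hs'⟩

/-- `1 ≤ Rsz` [decided toy] -/
theorem one_le_Rsz : 1 ≤ Rsz F rr g := Nat.one_le_pow _ _ (by have := F.hL.2; omega)

end Size

/-! ## §4 The witness for a constant run and a string with trivial product observable -/

section Witness

variable (F : T4Family) (G : Type) [GaugeGroup G] [MeasurableSpace G] [HaarData G] [RegularGaugeGroup G]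

/-- **THE WITNESS TERM at the constant run `g₀ ≡ g` for a string whose product observable is `1`** (module docstring
§4): the sibling's construction with `ZtoyOf g₀ os` and the size function `Rsz F rr g`. [decided toy] -/
def toyWitnessOf (C : T4PrintedShapeBanking.Consts) (O : PrintedO1s) (rr d n : ℕ) {g : ℝ} {g₀ : ℕ → ℝ}
    (hg₀ : ∀ K, g₀ K = g) {os : List (ULoop F)}
    (hobs : ∀ (K : ℕ) (U : GaugeField (F.P K) 0 G), T4GenFunBounds.prodObs ((toyData F G).scheme g₀) K os U = 1) :
    CountRoadWitness (toyData F G) C O rr d n g₀ os Unit Empty Unit where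
  l₀ := 1
  vol := 1
  l₀_pos := one_pos
  vol_pos := one_pos
  K₀ := 0
  T := toyT
  A := fun K t _ => ZtoyOf F G g₀ os K t
  A' := fun K t _ => ZtoyOf F G g₀ os (K + 1) t
  shA := fun _ _ _ => 0
  shB := fun _ _ _ => 0
  dead := fun _ _ _ => 0
  dead' := fun _ _ _ => 0
  nup := fun _ _ => 0
  mup := fun _ _ => 0
  Nup := 0
  Cc := fun K _ _ => nuToyOf F G g₀ os K
  Rr := fun _ _ _ => 0
  CcRec := fun _ _ _ => 0
  RrRec := fun _ _ _ => 0
  ν := nuToyOf F G g₀ os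
  u := fun _ => 0
  s₂ := fun _ => 0
  q₀ := fun _ => 0
  r := fun _ => 0
  s := fun _ => 0
  Wsh := fun _ => 0
  reprA := fun K t _ _ => by rw [toyT, sum_singleton]; rfl
  reprB := fun K t _ _ => by rw [toyT, sum_singleton]; rfl
  c₀ := 1
  n₁ := 0
  c₀_pos := one_pos
  floor := fun K _ => (smallFieldMass_toy F G K (g₀ K)).ge
  floor' := fun K _ => (smallFieldMass_toy F G (K + 1) (g₀ (K + 1))).ge
  sites := fun K _ => by rw [toy_numSites, Nat.cast_zero]
  sites' := fun K _ => by rw [toy_numSites, Nat.cast_zero]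
  Nup_nonneg := le_rfl
  nup_bd := fun _ _ _ _ => ⟨le_rfl, le_rfl⟩
  mup_bd := fun _ _ _ _ => ⟨le_rfl, le_rfl⟩
  R := fun _ _ => Rsz F rr g
  isRj := fun K s _ => by rw [toy_flow_g]; exact (hg₀ K).symm ▸ isRj_Rsz F rr g
  one_le_R := fun _ _ _ => one_le_Rsz F rr g
  ped := toyPedR
  cellP := fun _ _ _ => (fun _ => 0, ∅)
  liveC := toyLive
  Zd := fun _ _ c => c.elim
  realised :=
    ⟨fun _ _ _ _ c => c.elim, fun _ _ _ _ c => c.elim, fun _ _ _ _ c => c.elim, fun _ _ _ _ c => c.elim,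
      fun _ _ _ _ c => c.elim, fun _ _ _ _ c => c.elim, fun _ _ _ _ c => c.elim⟩
  κ := fun _ _ _ _ => 0
  κ' := fun _ _ _ _ => 0
  cost_le := fun _ _ τ hτ => (not_mem_badTerms_toy _ _ _ hτ).elim
  cost_le' := fun _ _ τ hτ => (not_mem_badTerms_toy _ _ _ hτ).elim
  Fc := fun _ _ => 0
  Rf := fun _ _ => 0
  Fc' := fun _ _ => 0
  Rf' := fun _ _ => 0
  price := fun _ _ _ _ τ hτ => (not_mem_badTerms_toy _ _ _ hτ).elim
  price' := fun _ _ _ _ τ hτ => (not_mem_badTerms_toy _ _ _ hτ).elim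
  up := fun _ _ _ _ c hc => (not_mem_badClasses_toy _ _ _ hc).elim
  dead_nonneg := fun _ _ _ _ c hc => (not_mem_badClasses_toy _ _ _ hc).elim
  resum := fun _ _ _ _ c hc => (not_mem_badClasses_toy _ _ _ hc).elim
  F_nonneg := fun _ _ _ _ c hc => (not_mem_badClasses_toy _ _ _ hc).elim
  up' := fun _ _ _ _ c hc => (not_mem_badClasses_toy _ _ _ hc).elim
  dead'_nonneg := fun _ _ _ _ c hc => (not_mem_badClasses_toy _ _ _ hc).elim
  resum' := fun _ _ _ _ c hc => (not_mem_badClasses_toy _ _ _ hc).elim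
  F'_nonneg := fun _ _ _ _ c hc => (not_mem_badClasses_toy _ _ _ hc).elim
  shell :=
    { nonneg := fun _ => le_rfl
      summable := summable_zero
      sh_nonneg_left := fun _ _ _ _ _ => le_rfl
      sh_le_left := fun K t _ _ _ => (ZtoyOf_pos F G g₀ os K t).le
      sh_nonneg_right := fun _ _ _ _ _ => le_rfl
      sh_le_right := fun K t _ _ _ => (ZtoyOf_pos F G g₀ os (K + 1) t).le
      left := fun _ _ _ => by simp
      right := fun _ _ _ => by simp }
  budget :=
    { nonneg := fun K t _ _ _ => by simpa only [sub_zero] using (ZtoyOf_pos F G g₀ os K t).le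
      lower := fun K t _ _ _ => by simpa only [sub_zero] using (exp_nuToyOf_mul F G hobs K t).le
      upper := fun K t _ _ _ => by simpa only [sub_zero, add_zero] using (exp_nuToyOf_mul F G hobs K t).ge
      uv_const := fun _ _ _ _ _ => by simp
      uv_radius := fun _ _ _ _ _ => by simp
      recent_remainder := fun _ _ _ _ _ => by simp
      recent_deviation := fun _ _ _ _ _ => by simp }
  sum_r := summable_zero
  sum_u := summable_zero
  sum_s := summable_zero
  sum_s₂ := summable_zero

/-- a run of the CONSTANT-flow toy is tuned to `(γ, g)` iff it is the constant sequence `g` with `0 < g ≤ γ`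
[decided toy] -/
theorem tuned_const_iff (γ g : ℝ) (g₀ : ℕ → ℝ) :
    (toyData F G).Tuned γ g g₀ ↔ (∀ K, g₀ K = g) ∧ 0 < g ∧ g ≤ γ := by
  constructor
  · intro h
    have hg : ∀ K, g₀ K = g := fun K => (h K).2
    refine ⟨hg, ?_, ?_⟩
    · have := ((h 0).1 0 le_rfl).1; rwa [toy_flow_g, hg 0] at this
    · have := ((h 0).1 0 le_rfl).2; rwa [toy_flow_g, hg 0] at this
  · rintro ⟨hg, hpos, hle⟩ K
    refine ⟨fun k _ => ?_, ?_⟩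
    · rw [toy_flow_g]; exact ⟨(hg K).symm ▸ hpos, (hg K).symm ▸ hle⟩
    · rw [toy_flow_g]; exact hg K

end Witness

/-! ## §5 The headline's `hData` on the toy datum over a subsingleton group, and at `SU(1)` -/

section HData

variable (F : T4Family) (G : Type) [GaugeGroup G] [MeasurableSpace G] [HaarData G] [RegularGaugeGroup G]

/-- **THE HEADLINE'S DISPLAYED ANTECEDENT `hData` HOLDS ON THE TOY DATUM over a subsingleton regular gauge group**:
`ForSmallCouplings (toyData F G) (fun g₀ => ∀ os, ∃ ι α π …, Nonempty (CountRoadWitness (toyData F G) C O rr d n g₀ os ι α π))`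
— the binder of `HistoryRealiseCellsRunHeadline.continuumYM4Torus_of_countRoad_fsc` verbatim, thresholds
`γ₀ = g₁ = 1`.  A node test of the SHAPE ((B) fails at this datum, `not_endStatementBPrinted_toy`); discharges nothing
of the nine; NE7b NOT proved. [decided toy] -/
theorem forSmallCouplings_countRoadWitness_toy [Subsingleton G] (C : T4PrintedShapeBanking.Consts) (O : PrintedO1s)
    (rr d n : ℕ) :
    ForSmallCouplings (toyData F G) fun g₀ => ∀ os : List (ULoop F),
      ∃ (ι α π : Type) (_ : DecidableEq ι) (_ : DecidableEq α) (_ : DecidableEq π),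
        Nonempty (CountRoadWitness (toyData F G) C O rr d n g₀ os ι α π) := by
  refine ⟨1, one_pos, fun γ _ _ => ⟨1, one_pos, fun g _ _ g₀ ht os => ?_⟩⟩
  have hg₀ : ∀ K, g₀ K = g := ((tuned_const_iff F G γ g g₀).1 ht).1
  exact ⟨Unit, Empty, Unit, inferInstance, inferInstance, inferInstance,
    ⟨toyWitnessOf F G C O rr d n hg₀ (fun K U => prodObs_eq_one (toyData F G) g₀ K os U)⟩⟩

/-- **… IN PARTICULAR AT `SU(1)`**, on every family `F`, for every `C O rr d n`: the headline's `hData` is a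
SATISFIABLE shape. [decided toy] -/
theorem forSmallCouplings_countRoadWitness_toySU1 (C : T4PrintedShapeBanking.Consts) (O : PrintedO1s) (rr d n : ℕ) :
    ForSmallCouplings (toyData F (Matrix.specialUnitaryGroup (Fin 1) ℂ)) fun g₀ => ∀ os : List (ULoop F),
      ∃ (ι α π : Type) (_ : DecidableEq ι) (_ : DecidableEq α) (_ : DecidableEq π),
        Nonempty (CountRoadWitness (toyData F (Matrix.specialUnitaryGroup (Fin 1) ℂ)) C O rr d n g₀ os ι α π) :=
  haveI := subsingleton_SU1
  forSmallCouplings_countRoadWitness_toy F _ C O rr d n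

/-- For the record, on ANY regular gauge group the EMPTY string is covered at every tuned run (the sibling's case,
now at a general constant coupling). [decided toy] -/
theorem nonempty_countRoadWitness_toy_nil (C : T4PrintedShapeBanking.Consts) (O : PrintedO1s) (rr d n : ℕ)
    {γ g : ℝ} {g₀ : ℕ → ℝ} (ht : (toyData F G).Tuned γ g g₀) :
    Nonempty (CountRoadWitness (toyData F G) C O rr d n g₀ ([] : List (ULoop F)) Unit Empty Unit) :=
  ⟨toyWitnessOf F G C O rr d n ((tuned_const_iff F G γ g g₀).1 ht).1 fun K U =>
    prodObs_nil G ((toyData F G).scheme g₀) K U⟩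

end HData

end

end Summit.QuantumFields.BalabanUV.T4Continuum.HistoryRealiseCellsRunApexWitnessData
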